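import Mathlib.Analysis.SpecialFunctions.Log.NegMulLog
import Mathlib.Analysis.Convex.SpecificFunctions.Basic
import Mathlib.Analysis.Complex.ExponentialBounds
import Literature.Barriers.ValiantsHypothesis.ShiftedPartialsCaseC2
import Literature.Barriers.ValiantsHypothesis.ShiftedPartialsCaseC3
import Literature.Barriers.ValiantsHypothesis.ShiftedPartialsGKKS
import Literature.Barriers.ValiantsHypothesis.ShiftedPartialsPermanentSide
import HarnessLib

/-!
# Shifted partial derivatives: Case C4 of Efremenko–Landsberg–Schenck–Weyman's Theorem 1.5

Support file for the barrier entry `ShiftedPartialDerivatives.lean` (`ShiftedPartialsCannotSeparate`,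
ELSW Thm. 1.5): the case of small order of differentiation `k < 3m/2` and shift `τ ≤ 3n²m/2`
(ELSW §6, "Case C4", there `n - 6√n·m < k` and `τ < n³/(6m)`). As printed: "Here we use the crude
estimate `rank((ℓ^{n-m}perm_m)_{(k,n-k)[τ]}) ≤ Σ_{j=0}^k binom(m,j)² binom(n²+τ-1, τ)` ... We compare
this with a lower bound on `I^{det_n,k}_{n-k+τ}` from [GKKS] ... `binom(n+k,2k) binom(n²+τ-2k,τ)`. So we
need to show `binom(n+k,2k) binom(n²+τ-2k,τ) > Σ_j binom(m,j)² binom(n²+τ-1,τ)` (12), or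
`dim S^{n-k+τ}ℂ^{n²} = binom(n²+n-k+τ-1, n-k+τ) < binom(n+k,2k) binom(n²+τ-2k,τ)` (13)."

**Proved here** (`caseC4`, any field): for `m ≥ 12`, `n > 2m²+2m`, `0 < k`, `2k < 3m` and
`2τ ≤ 3n²m`, `rank((ℓ^{n-m}perm_m)_{(k,n-k)[τ]}) < rank((det_n)_{(k,n-k)[τ]})`, combining the tree's
proved GKKS bound (`gkks_bound`, `ShiftedPartialsGKKS.lean`) with the crude permanent bound
(`shiftedPartialsRank_paddedPerPoly_le_sum_mul`, `ShiftedPartialsPermanentSide.lean`) when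
`4τ ≤ n²m`, and with the strict dimension bound `rank < dim S^{m+τ}`
(`shiftedPartialsRank_paddedPerPoly_lt_choose`, `ShiftedPartialsCaseC2.lean`) when `4τ > n²m`.
Discrepancies with the printed text (recorded, not a change of statement of the barrier): ELSW's
thresholds `k > n - 6√n·m`, `τ < n³/(6m)` belong to their four-case split which does not close for
`2m²+2m < n < 27m²` (Case C3's printed condition `τ > 6n³/m` and Case C4's `τ < n³/(6m)` do not
overlap); the tree's split (`caseC1`–`caseC4`) uses `k ≥ 3m/2` / `k < 3m/2` and `τ ≷ 3n²m/2` instead, with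
the same four mechanisms. The explicit inequalities: with `binom(n+k,2k) ≥ (e(n-k+1)/(2k))^{2k}/(e√(2k))`
(Stirling) and `binom(n²+τ-1,τ)/binom(n²-2k+τ-1,τ) ≤ (1+τ/(n²-2k))^{2k}`,
`binom(n²+m+τ-1,m+τ)/binom(n²+τ-1,τ) ≤ (1+(n²-1)/(τ+1))^m`, the comparison reduces to the real
inequalities `cond_A1` (`2k ≤ m`), `cond_A2` (`m < 2k`), `cond_B1` (`n²m ≤ 4τ ≤ 2n²m`), `cond_B2`
(`n²m ≤ 2τ ≤ 3n²m`), each proved for all `k` in range from its values at the two extreme orders by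
log-concavity of `k ↦ (c/(2k))^{2k}` (`pow_div_ge_min`).

## References

* [EfremenkoLandsbergSchenckWeyman2018] K. Efremenko, J. M. Landsberg, H. Schenck, J. Weyman, *The
  method of shifted partial derivatives cannot separate the permanent from the determinant*, Math.
  Comp. 87 (2018), §6 (Case C4, (12)–(13)).
* [GuptaKamathKayalSaptharishi2014] A. Gupta, P. Kamath, N. Kayal, R. Saptharishi, *Approaching the
  chasm at depth four*, J. ACM 61 (2014), §5 (Cor. 16).
-/

noncomputable section

namespace Literature.Barriers.ValiantsHypothesis

open Real Literature.Computability.AlgebraicComplexity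

/-! ### The log-concavity device -/

/-- `x ↦ 2x log c - 2x log 2 + 2 negMulLog x` (`= 2x log(c/(2x))`) is concave on `[0, ∞)`. [folklore] -/
theorem concaveOn_mul_log_div (c : ℝ) :
    ConcaveOn ℝ (Set.Ici (0 : ℝ)) (fun x : ℝ => 2 * x * Real.log c - 2 * x * Real.log 2 + 2 * Real.negMulLog x) := by
  have h1 : ConcaveOn ℝ (Set.Ici (0 : ℝ)) (fun x : ℝ => 2 * x * Real.log c - 2 * x * Real.log 2) := by
    have : (fun x : ℝ => 2 * x * Real.log c - 2 * x * Real.log 2) =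
        fun x => (2 * Real.log c - 2 * Real.log 2) * x := by ext x; ring
    rw [this]
    exact (LinearMap.concaveOn (LinearMap.mul ℝ ℝ (2 * Real.log c - 2 * Real.log 2)) (convex_Ici 0))
  exact h1.add (Real.concaveOn_negMulLog.smul (by norm_num : (0 : ℝ) ≤ 2))

/-- At a positive real that function is `2x log (c/(2x))`. [folklore] -/
theorem mul_log_div_eq {c x : ℝ} (hc : 0 < c) (hx : 0 < x) :
    2 * x * Real.log c - 2 * x * Real.log 2 + 2 * Real.negMulLog x = 2 * x * Real.log (c / (2 * x)) := by
  rw [Real.negMulLog, Real.log_div hc.ne' (by positivity), Real.log_mul (by norm_num) hx.ne']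
  ring

/-- **Log-concavity device**: for `0 < c` and naturals `1 ≤ k₁ ≤ k ≤ k₂`, `(c/(2k))^{2k}` is at least the
smaller of its values at `k₁` and `k₂` (`k ↦ 2k log(c/(2k))` is concave). [folklore] -/
theorem pow_div_ge_min {c A : ℝ} (hc : 0 < c) {k₁ k k₂ : ℕ} (hk₁ : 1 ≤ k₁) (h₁ : k₁ ≤ k) (h₂ : k ≤ k₂)
    (hA₁ : A ≤ (c / (2 * k₁)) ^ (2 * k₁)) (hA₂ : A ≤ (c / (2 * k₂)) ^ (2 * k₂)) :
    A ≤ (c / (2 * k)) ^ (2 * k) := by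
  -- positivity of the three powers
  have hpos : ∀ j : ℕ, 1 ≤ j → 0 < (c / (2 * (j : ℝ))) ^ (2 * j) := fun j hj => by positivity
  have hk : 1 ≤ k := hk₁.trans h₁
  have hk₂ : 1 ≤ k₂ := hk.trans h₂
  by_cases hA : A ≤ 0
  · exact hA.trans (hpos k hk).le
  push Not at hA
  -- pass to logarithms
  set f : ℝ → ℝ := fun x => 2 * x * Real.log c - 2 * x * Real.log 2 + 2 * Real.negMulLog x with hf
  have hfval : ∀ j : ℕ, 1 ≤ j → f j = Real.log ((c / (2 * (j : ℝ))) ^ (2 * j)) := by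
    intro j hj
    rw [hf]
    simp only
    rw [mul_log_div_eq hc (by exact_mod_cast hj), Real.log_pow]
    push_cast; ring
  have hconc := concaveOn_mul_log_div c
  have hseg : (k : ℝ) ∈ segment ℝ (k₁ : ℝ) (k₂ : ℝ) := by
    rw [segment_eq_Icc (by exact_mod_cast h₁.trans h₂)]
    exact ⟨by exact_mod_cast h₁, by exact_mod_cast h₂⟩
  have hmin := hconc.ge_on_segment (x := (k₁ : ℝ)) (y := (k₂ : ℝ)) (z := (k : ℝ))
    (by simp) (by simp) hseg
  have e1 := hfval k₁ hk₁; have e2 := hfval k₂ hk₂; have e3 := hfval k hk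
  simp only [hf] at e1 e2 e3
  rw [e1, e2, e3] at hmin
  -- `log A ≤ min ≤ log value`
  have hlogA : Real.log A ≤ min (Real.log ((c / (2 * (k₁ : ℝ))) ^ (2 * k₁)))
      (Real.log ((c / (2 * (k₂ : ℝ))) ^ (2 * k₂))) :=
    le_min (Real.log_le_log hA hA₁) (Real.log_le_log hA hA₂)
  exact (Real.log_le_log_iff hA (hpos k hk)).1 (hlogA.trans hmin)

/-! ### Elementary bounds -/

/-- `(1 + x/m)^m ≤ e^x` for `x ≥ 0`. [folklore] -/
theorem one_add_div_pow_le_exp {x : ℝ} (hx : 0 ≤ x) {m : ℕ} (hm : 1 ≤ m) :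
    (1 + x / m) ^ m ≤ Real.exp x := by
  have hm0 : (0 : ℝ) < m := by exact_mod_cast hm
  calc (1 + x / m) ^ m ≤ (Real.exp (x / m)) ^ m := by
        apply pow_le_pow_left₀ (by positivity)
        have := Real.add_one_le_exp (x / m); linarith
    _ = Real.exp x := by rw [← Real.exp_nat_mul]; congr 1; field_simp

/-- `√(2k) ≤ k + 1/2`. [folklore] -/
theorem sqrt_two_mul_le (k : ℕ) : √(2 * (k : ℝ)) ≤ (k : ℝ) + 1 / 2 := by
  rw [Real.sqrt_le_left (by positivity)]
  nlinarith [sq_nonneg ((k : ℝ) - 1 / 2)]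

/-- `√(3m) ≤ m/4 + 3`. [folklore] -/
theorem sqrt_three_mul_le (m : ℕ) : √(3 * (m : ℝ)) ≤ (m : ℝ) / 4 + 3 := by
  rw [Real.sqrt_le_left (by positivity)]
  nlinarith [sq_nonneg ((m : ℝ) / 4 - 3)]


/-- `(6/5)^(3m-2) ≥ 20.1 (m/4 + 3)` for `m ≥ 12`. [folklore] -/
theorem pow_six_fifths_ge {m : ℕ} (hm : 12 ≤ m) : (20.1 : ℝ) * ((m : ℝ) / 4 + 3) ≤ (6 / 5 : ℝ) ^ (3 * m - 2) := by
  induction m, hm using Nat.le_induction with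
  | base => norm_num
  | succ m hm ih =>
    have : (12 : ℝ) ≤ m := by exact_mod_cast hm
    rw [show 3 * (m + 1) - 2 = 3 * m - 2 + 3 by omega, pow_add]
    push_cast
    nlinarith [ih]

/-- `n² ≥ 5002 k₂` for `m ≥ 12`, `n > 2m²+2m`, `2k₂ ≤ 3m-1`. [folklore] -/
theorem n_sq_ge {m n : ℝ} {k₂ : ℕ} (hm : 12 ≤ m) (hn : 2 * m ^ 2 + 2 * m + 1 ≤ n) (hk₂ : 2 * (k₂ : ℝ) ≤ 3 * m - 1) :
    5002 * (k₂ : ℝ) ≤ n ^ 2 := by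
  have hn0 : 0 < n := by nlinarith
  have hm3 : (12 : ℝ) ^ 2 * m ≤ m ^ 3 := by nlinarith
  have hm4 : (12 : ℝ) ^ 3 * m ≤ m ^ 4 := by nlinarith
  have hn2 : (2 * m ^ 2 + 2 * m + 1) ^ 2 ≤ n ^ 2 := by nlinarith
  nlinarith

/-! ### Condition (B2): `Nm ≤ 2τ ≤ 3Nm` -/

/-- The base of (B2) at the top order: `e(n-k₂+1)/((1 + (3m/2) n²/(n²-2k₂)) 2k₂) ≥ 6/5`. [folklore] -/
theorem base_B2 {m n : ℝ} {k₂ : ℕ} (hm : 12 ≤ m) (hn : 2 * m ^ 2 + 2 * m + 1 ≤ n) (hk₂ : 2 * (k₂ : ℝ) ≤ 3 * m - 1)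
    (hk₂1 : (1 : ℝ) ≤ k₂) :
    (6 / 5 : ℝ) ≤ Real.exp 1 * (n - k₂ + 1) / (1 + 3 * m / 2 * (n ^ 2 / (n ^ 2 - 2 * k₂))) / (2 * k₂) := by
  have hE := Real.exp_one_gt_d9
  have hn0 : 0 < n := by nlinarith
  have hN : 5002 * (k₂ : ℝ) ≤ n ^ 2 := n_sq_ge hm hn hk₂
  have hNk : 0 < n ^ 2 - 2 * k₂ := by nlinarith
  have hratio : n ^ 2 / (n ^ 2 - 2 * k₂) ≤ 1.0004 := by
    rw [div_le_iff₀ hNk]; nlinarith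
  have hden : 0 < 1 + 3 * m / 2 * (n ^ 2 / (n ^ 2 - 2 * k₂)) := by positivity
  rw [le_div_iff₀ (by positivity), le_div_iff₀ hden]
  have h1 : 1 + 3 * m / 2 * (n ^ 2 / (n ^ 2 - 2 * k₂)) ≤ 1 + 3 * m / 2 * 1.0004 := by nlinarith
  have h2 : (6 / 5 : ℝ) * (2 * k₂) * (1 + 3 * m / 2 * (n ^ 2 / (n ^ 2 - 2 * k₂))) ≤
      (6 / 5) * (3 * m - 1) * (1 + 3 * m / 2 * 1.0004) := by
    apply mul_le_mul (by nlinarith) h1 hden.le (by nlinarith)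
  have h3 : 2.7182818283 * (n - k₂ + 1) ≤ Real.exp 1 * (n - k₂ + 1) :=
    mul_le_mul_of_nonneg_right hE.le (by nlinarith)
  nlinarith [sq_nonneg (m - 6)]


set_option maxHeartbeats 400000 in
/-- **Condition (B2)** of the tree's Case C4 split: for `m ≥ 12`, `n > 2m²+2m`, `1 ≤ k`, `2k < 3m`:
`(1+2/m)^m (1 + (3m/2) N/(N-2k))^{2k} e √(2k) ≤ (e(n-k+1)/(2k))^{2k}` (`N = n²`; makes (13) hold for `n²m ≤ 2τ ≤ 3n²m`).
[cite: EfremenkoLandsbergSchenckWeyman2018, §6 (Case C4, (13))] -/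
theorem cond_B2 {m n k : ℕ} (hm : 12 ≤ m) (hn : 2 * m ^ 2 + 2 * m < n) (hk1 : 1 ≤ k) (hk : 2 * k < 3 * m) :
    (1 + 2 / (m : ℝ)) ^ m * (1 + 3 * (m : ℝ) / 2 * ((n : ℝ) ^ 2 / ((n : ℝ) ^ 2 - 2 * k))) ^ (2 * k) *
        (Real.exp 1 * √(2 * (k : ℝ))) ≤
      (Real.exp 1 * ((n : ℝ) - k + 1) / (2 * k)) ^ (2 * k) := by
  obtain ⟨k₂, hk₂a, hk₂b⟩ : ∃ k₂ : ℕ, 3 * m ≤ 2 * k₂ + 2 ∧ 2 * k₂ + 1 ≤ 3 * m := ⟨(3 * m - 1) / 2, by omega, by omega⟩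
  have hkk₂ : k ≤ k₂ := by omega
  have hE1 := Real.exp_one_lt_d9
  have hE2 := Real.exp_one_gt_d9
  have he0 : 0 < Real.exp 1 := Real.exp_pos 1
  have hmR : (12 : ℝ) ≤ m := by exact_mod_cast hm
  have hnR : 2 * (m : ℝ) ^ 2 + 2 * m + 1 ≤ n := by exact_mod_cast hn
  have hkR : (1 : ℝ) ≤ k := by exact_mod_cast hk1
  have hk₂R : 2 * (k₂ : ℝ) ≤ 3 * m - 1 := by
    have : (2 * k₂ + 1 : ℝ) ≤ 3 * m := by exact_mod_cast hk₂b
    linarith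
  have hk₂1 : (1 : ℝ) ≤ k₂ := by exact_mod_cast (hk1.trans hkk₂)
  have hkk₂R : (k : ℝ) ≤ k₂ := by exact_mod_cast hkk₂
  have hk3m : 2 * (k : ℝ) ≤ 3 * m - 1 := by linarith
  have hn0 : (0 : ℝ) < n := by nlinarith
  have hN : 5002 * (k₂ : ℝ) ≤ (n : ℝ) ^ 2 := n_sq_ge hmR hnR hk₂R
  have hNk : (0 : ℝ) < (n : ℝ) ^ 2 - 2 * k := by linarith
  have hNk₂ : (0 : ℝ) < (n : ℝ) ^ 2 - 2 * k₂ := by linarith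
  -- the `k₂`-data
  set θ : ℝ := 3 * (m : ℝ) / 2 * ((n : ℝ) ^ 2 / ((n : ℝ) ^ 2 - 2 * k)) with hθ
  set θ₂ : ℝ := 3 * (m : ℝ) / 2 * ((n : ℝ) ^ 2 / ((n : ℝ) ^ 2 - 2 * k₂)) with hθ₂
  have hθ0 : 0 < θ := by positivity
  have hθθ₂ : θ ≤ θ₂ := by
    rw [hθ, hθ₂]
    refine mul_le_mul_of_nonneg_left ?_ (by positivity)
    exact div_le_div_of_nonneg_left (by positivity) hNk₂ (by linarith)
  set c : ℝ := Real.exp 1 * ((n : ℝ) - k₂ + 1) / (1 + θ₂) with hc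
  have hc0 : 0 < c := by rw [hc]; apply div_pos _ (by positivity); apply mul_pos he0; nlinarith
  have hbase := base_B2 hmR hnR hk₂R hk₂1
  rw [← hθ₂, ← hc] at hbase
  -- the uniform bound `A'` for the left factor
  set A : ℝ := Real.exp 1 ^ 2 * (Real.exp 1 * ((m : ℝ) / 4 + 3)) with hA
  have hleft : (1 + 2 / (m : ℝ)) ^ m * (Real.exp 1 * √(2 * (k : ℝ))) ≤ A := by
    rw [hA]
    refine mul_le_mul ?_ ?_ (by positivity) (by positivity)
    · have := one_add_div_pow_le_exp (x := 2) (by norm_num) (m := m) (by omega)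
      rwa [show Real.exp 2 = Real.exp 1 ^ 2 by rw [← Real.exp_nat_mul]; norm_num] at this
    · refine mul_le_mul_of_nonneg_left ?_ he0.le
      calc √(2 * (k : ℝ)) ≤ √(3 * (m : ℝ)) := Real.sqrt_le_sqrt (by linarith)
        _ ≤ (m : ℝ) / 4 + 3 := sqrt_three_mul_le m
  have hA0 : 0 < A := by positivity
  have he3 : Real.exp 1 ^ 2 * Real.exp 1 ≤ 20.1 := by nlinarith
  have hAle : A ≤ 20.1 * ((m : ℝ) / 4 + 3) := by
    rw [hA]; nlinarith
  -- endpoint `k₁ = 1`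
  have hc_ge : 12 / 5 * (k₂ : ℝ) ≤ c := by
    have h := (le_div_iff₀ (by positivity : (0 : ℝ) < 2 * k₂)).1 hbase
    linarith
  have hk₂m : 3 * (m : ℝ) ≤ 2 * k₂ + 2 := by exact_mod_cast hk₂a
  have hA1 : A ≤ (c / (2 * ((1 : ℕ) : ℝ))) ^ (2 * 1) := by
    simp only [Nat.cast_one, mul_one]
    have : (17 : ℝ) / 10 * m ≤ c / 2 := by linarith
    have h2 : ((17 : ℝ) / 10 * m) ^ 2 ≤ (c / 2) ^ 2 := pow_le_pow_left₀ (by positivity) this 2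
    have h3 : 20.1 * ((m : ℝ) / 4 + 3) ≤ ((17 : ℝ) / 10 * m) ^ 2 := by nlinarith [hmR]
    linarith [hAle, h2, h3]
  -- endpoint `k₂`
  have hA2 : A ≤ (c / (2 * (k₂ : ℝ))) ^ (2 * k₂) := by
    have h1 : (6 / 5 : ℝ) ^ (2 * k₂) ≤ (c / (2 * (k₂ : ℝ))) ^ (2 * k₂) :=
      pow_le_pow_left₀ (by norm_num) hbase _
    have h2 : (6 / 5 : ℝ) ^ (3 * m - 2) ≤ (6 / 5 : ℝ) ^ (2 * k₂) :=
      pow_le_pow_right₀ (by norm_num) (by omega)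
    exact hAle.trans ((pow_six_fifths_ge hm).trans (h2.trans h1))
  have hmid : A ≤ (c / (2 * (k : ℝ))) ^ (2 * k) := pow_div_ge_min hc0 le_rfl hk1 hkk₂ hA1 hA2
  -- assemble
  have hcθ : c * (1 + θ) / (2 * k) ≤ Real.exp 1 * ((n : ℝ) - k + 1) / (2 * k) := by
    refine div_le_div_of_nonneg_right ?_ (by positivity)
    have h1 : c * (1 + θ) ≤ c * (1 + θ₂) := mul_le_mul_of_nonneg_left (by linarith) hc0.le
    have hθ₂0 : 0 < 1 + θ₂ := by positivity
    have h2 : c * (1 + θ₂) = Real.exp 1 * ((n : ℝ) - k₂ + 1) := by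
      rw [hc]; field_simp
    have h3 : Real.exp 1 * ((n : ℝ) - k₂ + 1) ≤ Real.exp 1 * ((n : ℝ) - k + 1) :=
      mul_le_mul_of_nonneg_left (by linarith) he0.le
    linarith
  calc (1 + 2 / (m : ℝ)) ^ m * (1 + θ) ^ (2 * k) * (Real.exp 1 * √(2 * (k : ℝ)))
      = ((1 + 2 / (m : ℝ)) ^ m * (Real.exp 1 * √(2 * (k : ℝ)))) * (1 + θ) ^ (2 * k) := by ring
    _ ≤ A * (1 + θ) ^ (2 * k) := mul_le_mul_of_nonneg_right hleft (by positivity)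
    _ ≤ (c / (2 * (k : ℝ))) ^ (2 * k) * (1 + θ) ^ (2 * k) :=
        mul_le_mul_of_nonneg_right hmid (by positivity)
    _ = (c * (1 + θ) / (2 * k)) ^ (2 * k) := by rw [← mul_pow]; congr 1; ring
    _ ≤ (Real.exp 1 * ((n : ℝ) - k + 1) / (2 * k)) ^ (2 * k) :=
        pow_le_pow_left₀ (by positivity) hcθ _

/-! ### Condition (B1): `Nm ≤ 4τ`, `2τ ≤ Nm` -/

/-- `3^(3m-2) ≥ 148.5 (m/4 + 3)` for `m ≥ 12`. [folklore] -/
theorem pow_three_ge {m : ℕ} (hm : 12 ≤ m) : (148.5 : ℝ) * ((m : ℝ) / 4 + 3) ≤ (3 : ℝ) ^ (3 * m - 2) := by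
  induction m, hm using Nat.le_induction with
  | base => norm_num
  | succ m hm ih =>
    have : (12 : ℝ) ≤ m := by exact_mod_cast hm
    rw [show 3 * (m + 1) - 2 = 3 * m - 2 + 3 by omega, pow_add]
    push_cast
    nlinarith [ih]

/-- The base of (B1) at the top order: `e(n-k₂+1)/((1 + (m/2) n²/(n²-2k₂)) 2k₂) ≥ 3`. [folklore] -/
theorem base_B1 {m n : ℝ} {k₂ : ℕ} (hm : 12 ≤ m) (hn : 2 * m ^ 2 + 2 * m + 1 ≤ n) (hk₂ : 2 * (k₂ : ℝ) ≤ 3 * m - 1)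
    (hk₂1 : (1 : ℝ) ≤ k₂) :
    (3 : ℝ) ≤ Real.exp 1 * (n - k₂ + 1) / (1 + m / 2 * (n ^ 2 / (n ^ 2 - 2 * k₂))) / (2 * k₂) := by
  have hE := Real.exp_one_gt_d9
  have hn0 : 0 < n := by nlinarith
  have hN : 5002 * (k₂ : ℝ) ≤ n ^ 2 := n_sq_ge hm hn hk₂
  have hNk : 0 < n ^ 2 - 2 * k₂ := by nlinarith
  have hratio : n ^ 2 / (n ^ 2 - 2 * k₂) ≤ 1.0004 := by
    rw [div_le_iff₀ hNk]; nlinarith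
  have hden : 0 < 1 + m / 2 * (n ^ 2 / (n ^ 2 - 2 * k₂)) := by positivity
  rw [le_div_iff₀ (by positivity), le_div_iff₀ hden]
  have h1 : 1 + m / 2 * (n ^ 2 / (n ^ 2 - 2 * k₂)) ≤ 1 + m / 2 * 1.0004 := by nlinarith
  have h2 : (3 : ℝ) * (2 * k₂) * (1 + m / 2 * (n ^ 2 / (n ^ 2 - 2 * k₂))) ≤
      3 * (3 * m - 1) * (1 + m / 2 * 1.0004) := by
    apply mul_le_mul (by nlinarith) h1 hden.le (by nlinarith)
  have h3 : 2.7182818283 * (n - k₂ + 1) ≤ Real.exp 1 * (n - k₂ + 1) :=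
    mul_le_mul_of_nonneg_right hE.le (by nlinarith)
  nlinarith [sq_nonneg (m - 6)]


set_option maxHeartbeats 400000 in
/-- **Condition (B1)** of the tree's Case C4 split: for `m ≥ 12`, `n > 2m²+2m`, `1 ≤ k`, `2k < 3m`:
`(1+4/m)^m (1 + (m/2) N/(N-2k))^{2k} e √(2k) ≤ (e(n-k+1)/(2k))^{2k}` (`N = n²`; makes (13) hold for `n²m ≤ 4τ ≤ 2n²m`).
[cite: EfremenkoLandsbergSchenckWeyman2018, §6 (Case C4, (13))] -/
theorem cond_B1 {m n k : ℕ} (hm : 12 ≤ m) (hn : 2 * m ^ 2 + 2 * m < n) (hk1 : 1 ≤ k) (hk : 2 * k < 3 * m) :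
    (1 + 4 / (m : ℝ)) ^ m * (1 + (m : ℝ) / 2 * ((n : ℝ) ^ 2 / ((n : ℝ) ^ 2 - 2 * k))) ^ (2 * k) *
        (Real.exp 1 * √(2 * (k : ℝ))) ≤
      (Real.exp 1 * ((n : ℝ) - k + 1) / (2 * k)) ^ (2 * k) := by
  obtain ⟨k₂, hk₂a, hk₂b⟩ : ∃ k₂ : ℕ, 3 * m ≤ 2 * k₂ + 2 ∧ 2 * k₂ + 1 ≤ 3 * m := ⟨(3 * m - 1) / 2, by omega, by omega⟩
  have hkk₂ : k ≤ k₂ := by omega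
  have hE1 := Real.exp_one_lt_d9
  have hE2 := Real.exp_one_gt_d9
  have he0 : 0 < Real.exp 1 := Real.exp_pos 1
  have hmR : (12 : ℝ) ≤ m := by exact_mod_cast hm
  have hnR : 2 * (m : ℝ) ^ 2 + 2 * m + 1 ≤ n := by exact_mod_cast hn
  have hkR : (1 : ℝ) ≤ k := by exact_mod_cast hk1
  have hk₂R : 2 * (k₂ : ℝ) ≤ 3 * m - 1 := by
    have : (2 * k₂ + 1 : ℝ) ≤ 3 * m := by exact_mod_cast hk₂b
    linarith
  have hk₂1 : (1 : ℝ) ≤ k₂ := by exact_mod_cast (hk1.trans hkk₂)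
  have hkk₂R : (k : ℝ) ≤ k₂ := by exact_mod_cast hkk₂
  have hk3m : 2 * (k : ℝ) ≤ 3 * m - 1 := by linarith
  have hn0 : (0 : ℝ) < n := by nlinarith
  have hN : 5002 * (k₂ : ℝ) ≤ (n : ℝ) ^ 2 := n_sq_ge hmR hnR hk₂R
  have hNk : (0 : ℝ) < (n : ℝ) ^ 2 - 2 * k := by linarith
  have hNk₂ : (0 : ℝ) < (n : ℝ) ^ 2 - 2 * k₂ := by linarith
  -- the `k₂`-data
  set θ : ℝ := (m : ℝ) / 2 * ((n : ℝ) ^ 2 / ((n : ℝ) ^ 2 - 2 * k)) with hθ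
  set θ₂ : ℝ := (m : ℝ) / 2 * ((n : ℝ) ^ 2 / ((n : ℝ) ^ 2 - 2 * k₂)) with hθ₂
  have hθ0 : 0 < θ := by positivity
  have hθθ₂ : θ ≤ θ₂ := by
    rw [hθ, hθ₂]
    refine mul_le_mul_of_nonneg_left ?_ (by positivity)
    exact div_le_div_of_nonneg_left (by positivity) hNk₂ (by linarith)
  set c : ℝ := Real.exp 1 * ((n : ℝ) - k₂ + 1) / (1 + θ₂) with hc
  have hc0 : 0 < c := by rw [hc]; apply div_pos _ (by positivity); apply mul_pos he0; nlinarith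
  have hbase := base_B1 hmR hnR hk₂R hk₂1
  rw [← hθ₂, ← hc] at hbase
  -- the uniform bound `A'` for the left factor
  set A : ℝ := Real.exp 1 ^ 4 * (Real.exp 1 * ((m : ℝ) / 4 + 3)) with hA
  have hleft : (1 + 4 / (m : ℝ)) ^ m * (Real.exp 1 * √(2 * (k : ℝ))) ≤ A := by
    rw [hA]
    refine mul_le_mul ?_ ?_ (by positivity) (by positivity)
    · have := one_add_div_pow_le_exp (x := 4) (by norm_num) (m := m) (by omega)
      rwa [show Real.exp 4 = Real.exp 1 ^ 4 by rw [← Real.exp_nat_mul]; norm_num] at this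
    · refine mul_le_mul_of_nonneg_left ?_ he0.le
      calc √(2 * (k : ℝ)) ≤ √(3 * (m : ℝ)) := Real.sqrt_le_sqrt (by linarith)
        _ ≤ (m : ℝ) / 4 + 3 := sqrt_three_mul_le m
  have hA0 : 0 < A := by positivity
  have he3 : Real.exp 1 ^ 4 * Real.exp 1 ≤ 148.5 := by
    have h2 : Real.exp 1 ^ 2 ≤ 7.38906 := by nlinarith
    have h4 : Real.exp 1 ^ 4 ≤ 54.5982 := by nlinarith [h2]
    nlinarith [h4]
  have hAle : A ≤ 148.5 * ((m : ℝ) / 4 + 3) := by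
    rw [hA]; nlinarith
  -- endpoint `k₁ = 1`
  have hc_ge : 6 * (k₂ : ℝ) ≤ c := by
    have h := (le_div_iff₀ (by positivity : (0 : ℝ) < 2 * k₂)).1 hbase
    linarith
  have hk₂m : 3 * (m : ℝ) ≤ 2 * k₂ + 2 := by exact_mod_cast hk₂a
  have hA1 : A ≤ (c / (2 * ((1 : ℕ) : ℝ))) ^ (2 * 1) := by
    simp only [Nat.cast_one, mul_one]
    have : (4 : ℝ) * m ≤ c / 2 := by linarith
    have h2 : ((4 : ℝ) * m) ^ 2 ≤ (c / 2) ^ 2 := pow_le_pow_left₀ (by positivity) this 2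
    have h3 : 148.5 * ((m : ℝ) / 4 + 3) ≤ ((4 : ℝ) * m) ^ 2 := by nlinarith [hmR]
    linarith [hAle, h2, h3]
  -- endpoint `k₂`
  have hA2 : A ≤ (c / (2 * (k₂ : ℝ))) ^ (2 * k₂) := by
    have h1 : (3 : ℝ) ^ (2 * k₂) ≤ (c / (2 * (k₂ : ℝ))) ^ (2 * k₂) :=
      pow_le_pow_left₀ (by norm_num) hbase _
    have h2 : (3 : ℝ) ^ (3 * m - 2) ≤ (3 : ℝ) ^ (2 * k₂) :=
      pow_le_pow_right₀ (by norm_num) (by omega)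
    exact hAle.trans ((pow_three_ge hm).trans (h2.trans h1))
  have hmid : A ≤ (c / (2 * (k : ℝ))) ^ (2 * k) := pow_div_ge_min hc0 le_rfl hk1 hkk₂ hA1 hA2
  -- assemble
  have hcθ : c * (1 + θ) / (2 * k) ≤ Real.exp 1 * ((n : ℝ) - k + 1) / (2 * k) := by
    refine div_le_div_of_nonneg_right ?_ (by positivity)
    have h1 : c * (1 + θ) ≤ c * (1 + θ₂) := mul_le_mul_of_nonneg_left (by linarith) hc0.le
    have hθ₂0 : 0 < 1 + θ₂ := by positivity
    have h2 : c * (1 + θ₂) = Real.exp 1 * ((n : ℝ) - k₂ + 1) := by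
      rw [hc]; field_simp
    have h3 : Real.exp 1 * ((n : ℝ) - k₂ + 1) ≤ Real.exp 1 * ((n : ℝ) - k + 1) :=
      mul_le_mul_of_nonneg_left (by linarith) he0.le
    linarith
  calc (1 + 4 / (m : ℝ)) ^ m * (1 + θ) ^ (2 * k) * (Real.exp 1 * √(2 * (k : ℝ)))
      = ((1 + 4 / (m : ℝ)) ^ m * (Real.exp 1 * √(2 * (k : ℝ)))) * (1 + θ) ^ (2 * k) := by ring
    _ ≤ A * (1 + θ) ^ (2 * k) := mul_le_mul_of_nonneg_right hleft (by positivity)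
    _ ≤ (c / (2 * (k : ℝ))) ^ (2 * k) * (1 + θ) ^ (2 * k) :=
        mul_le_mul_of_nonneg_right hmid (by positivity)
    _ = (c * (1 + θ) / (2 * k)) ^ (2 * k) := by rw [← mul_pow]; congr 1; ring
    _ ≤ (Real.exp 1 * ((n : ℝ) - k + 1) / (2 * k)) ^ (2 * k) :=
        pow_le_pow_left₀ (by positivity) hcθ _


/-! ### Condition (A1): `4τ ≤ Nm`, `2k ≤ m` -/

/-- `e (k+1)(k+1/2) < 10.24^k` for `k ≥ 1`. [folklore] -/
theorem pow_A1 {k : ℕ} (hk : 1 ≤ k) :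
    Real.exp 1 * ((k : ℝ) + 1) * ((k : ℝ) + 1 / 2) < (10.24 : ℝ) ^ k := by
  have hE1 := Real.exp_one_lt_d9
  induction k, hk using Nat.le_induction with
  | base => norm_num; nlinarith
  | succ k hk ih =>
    have hk1 : (1 : ℝ) ≤ k := by exact_mod_cast hk
    have he0 : 0 < Real.exp 1 := Real.exp_pos 1
    rw [pow_succ]
    push_cast
    nlinarith [mul_pos he0 (by linarith : (0 : ℝ) < k)]

/-- The constant base of (A1): `(n-k₂+1)/(2m(1 + (m/4) n²/(n²-2k₂))) ≥ 3.2` for `2k₂ ≤ m`. [folklore] -/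
theorem base_A1 {m n : ℝ} {k₂ : ℕ} (hm : 12 ≤ m) (hn : 2 * m ^ 2 + 2 * m + 1 ≤ n) (hk₂ : 2 * (k₂ : ℝ) ≤ m) :
    (3.2 : ℝ) ≤ (n - k₂ + 1) / (2 * m * (1 + m / 4 * (n ^ 2 / (n ^ 2 - 2 * k₂)))) := by
  have hn0 : 0 < n := by nlinarith
  have hN : 5002 * (k₂ : ℝ) ≤ n ^ 2 := n_sq_ge hm hn (by linarith)
  have hk0 : (0 : ℝ) ≤ k₂ := by positivity
  have hNk : 0 < n ^ 2 - 2 * k₂ := by nlinarith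
  have hratio : n ^ 2 / (n ^ 2 - 2 * k₂) ≤ 1.0004 := by
    rw [div_le_iff₀ hNk]; nlinarith
  have hden : 0 < 2 * m * (1 + m / 4 * (n ^ 2 / (n ^ 2 - 2 * k₂))) := by positivity
  rw [le_div_iff₀ hden]
  have h1 : 2 * m * (1 + m / 4 * (n ^ 2 / (n ^ 2 - 2 * k₂))) ≤ 2 * m * (1 + m / 4 * 1.0004) := by
    refine mul_le_mul_of_nonneg_left ?_ (by positivity); nlinarith
  nlinarith [mul_nonneg (by linarith : (0 : ℝ) ≤ m - 12) (by linarith : (0 : ℝ) ≤ 0.39936 * m - 0.10768)]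

/-- **Condition (A1)** of the tree's Case C4 split: for `m ≥ 12`, `n > 2m²+2m`, `1 ≤ k`, `2k ≤ m`:
`(k+1) binom(m,k)² (1 + (m/4) N/(N-2k))^{2k} e √(2k) < (e(n-k+1)/(2k))^{2k}` (`N = n²`; makes (12) hold for `4τ ≤ n²m`, `2k ≤ m`).
[cite: EfremenkoLandsbergSchenckWeyman2018, §6 (Case C4, (12))] -/
theorem cond_A1 {m n k : ℕ} (hm : 12 ≤ m) (hn : 2 * m ^ 2 + 2 * m < n) (hk1 : 1 ≤ k) (hk : 2 * k ≤ m) :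
    ((k : ℝ) + 1) * ((m.choose k : ℕ) : ℝ) ^ 2 *
        (1 + (m : ℝ) / 4 * ((n : ℝ) ^ 2 / ((n : ℝ) ^ 2 - 2 * k))) ^ (2 * k) * (Real.exp 1 * √(2 * (k : ℝ))) <
      (Real.exp 1 * ((n : ℝ) - k + 1) / (2 * k)) ^ (2 * k) := by
  set k₂ := m / 2 with hk₂def
  have hkk₂ : k ≤ k₂ := by omega
  have he0 : 0 < Real.exp 1 := Real.exp_pos 1
  have hmR : (12 : ℝ) ≤ m := by exact_mod_cast hm
  have hnR : 2 * (m : ℝ) ^ 2 + 2 * m + 1 ≤ n := by exact_mod_cast hn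
  have hkR : (1 : ℝ) ≤ k := by exact_mod_cast hk1
  have hk₂R : 2 * (k₂ : ℝ) ≤ m := by
    have : 2 * k₂ ≤ m := by omega
    exact_mod_cast this
  have hkk₂R : (k : ℝ) ≤ k₂ := by exact_mod_cast hkk₂
  have hn0 : (0 : ℝ) < n := by nlinarith
  have hN : 5002 * (k₂ : ℝ) ≤ (n : ℝ) ^ 2 := n_sq_ge hmR hnR (by linarith)
  have hNk : (0 : ℝ) < (n : ℝ) ^ 2 - 2 * k := by linarith
  have hNk₂ : (0 : ℝ) < (n : ℝ) ^ 2 - 2 * k₂ := by linarith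
  set θ : ℝ := (m : ℝ) / 4 * ((n : ℝ) ^ 2 / ((n : ℝ) ^ 2 - 2 * k)) with hθ
  set θ₂ : ℝ := (m : ℝ) / 4 * ((n : ℝ) ^ 2 / ((n : ℝ) ^ 2 - 2 * k₂)) with hθ₂
  have hθ0 : 0 < θ := by positivity
  have hθθ₂ : θ ≤ θ₂ := by
    rw [hθ, hθ₂]
    refine mul_le_mul_of_nonneg_left ?_ (by positivity)
    exact div_le_div_of_nonneg_left (by positivity) hNk₂ (by linarith)
  -- the base
  set b : ℝ := ((n : ℝ) - k + 1) / (2 * m * (1 + θ)) with hb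
  have hbase := base_A1 hmR hnR hk₂R
  rw [← hθ₂] at hbase
  have hb32 : (3.2 : ℝ) ≤ b := by
    refine hbase.trans ?_
    rw [hb]
    have hden : (0 : ℝ) < 2 * m * (1 + θ) := by positivity
    rw [div_le_div_iff₀ (by positivity) hden]
    have h1 : ((n : ℝ) - k₂ + 1) ≤ ((n : ℝ) - k + 1) := by linarith
    have h2 : 2 * (m : ℝ) * (1 + θ) ≤ 2 * m * (1 + θ₂) := by nlinarith
    have h3 : (0 : ℝ) ≤ (n : ℝ) - k₂ + 1 := by nlinarith
    calc ((n : ℝ) - k₂ + 1) * (2 * m * (1 + θ)) ≤ ((n : ℝ) - k₂ + 1) * (2 * m * (1 + θ₂)) :=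
          mul_le_mul_of_nonneg_left h2 h3
      _ ≤ ((n : ℝ) - k + 1) * (2 * m * (1 + θ₂)) := mul_le_mul_of_nonneg_right h1 (by positivity)
  have hb0 : 0 < b := by linarith
  -- binomial bound `binom(m,k) ≤ (em/k)^k`
  have hchoose : ((m.choose k : ℕ) : ℝ) ≤ (Real.exp 1 * m / k) ^ k := by
    have h1 : ((m.choose k : ℕ) : ℝ) ≤ (m : ℝ) ^ k / (k.factorial : ℝ) := Nat.choose_le_pow_div k m
    have h2 := pow_div_exp_le_factorial k
    have hk0 : (0 : ℝ) < k := by linarith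
    calc ((m.choose k : ℕ) : ℝ) ≤ (m : ℝ) ^ k / (k.factorial : ℝ) := h1
      _ ≤ (m : ℝ) ^ k / (((k : ℝ) / Real.exp 1) ^ k) :=
          div_le_div_of_nonneg_left (by positivity) (by positivity) h2
      _ = (Real.exp 1 * m / k) ^ k := by
          rw [← div_pow]; congr 1; field_simp
  -- the key identity `b · (e m (1+θ)/k) = e (n-k+1)/(2k)`
  have hident : b * (Real.exp 1 * m * (1 + θ) / k) = Real.exp 1 * ((n : ℝ) - k + 1) / (2 * k) := by
    rw [hb]
    have : (0 : ℝ) < m := by linarith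
    field_simp
  have hpow : (10.24 : ℝ) ^ k ≤ b ^ (2 * k) := by
    rw [pow_mul]
    exact pow_le_pow_left₀ (by norm_num) (by nlinarith) k
  have hA := pow_A1 hk1
  have hsq : √(2 * (k : ℝ)) ≤ (k : ℝ) + 1 / 2 := sqrt_two_mul_le k
  -- assemble
  have hX0 : 0 < Real.exp 1 * m * (1 + θ) / k := by positivity
  calc ((k : ℝ) + 1) * ((m.choose k : ℕ) : ℝ) ^ 2 * (1 + θ) ^ (2 * k) * (Real.exp 1 * √(2 * (k : ℝ)))
      ≤ ((k : ℝ) + 1) * ((Real.exp 1 * m / k) ^ k) ^ 2 * (1 + θ) ^ (2 * k) *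
          (Real.exp 1 * ((k : ℝ) + 1 / 2)) := by
        gcongr
    _ = (Real.exp 1 * ((k : ℝ) + 1) * ((k : ℝ) + 1 / 2)) * (Real.exp 1 * m * (1 + θ) / k) ^ (2 * k) := by
        rw [← pow_mul, div_pow, div_pow, mul_pow, mul_pow (Real.exp 1 * m)]; ring
    _ < (10.24 : ℝ) ^ k * (Real.exp 1 * m * (1 + θ) / k) ^ (2 * k) :=
        mul_lt_mul_of_pos_right hA (by positivity)
    _ ≤ b ^ (2 * k) * (Real.exp 1 * m * (1 + θ) / k) ^ (2 * k) :=
        mul_le_mul_of_nonneg_right hpow (by positivity)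
    _ = (Real.exp 1 * ((n : ℝ) - k + 1) / (2 * k)) ^ (2 * k) := by rw [← mul_pow, hident]


/-! ### Condition (A2): `4τ ≤ Nm`, `m < 2k < 3m` -/

/-- `(m+1) 4^m · 2.7182818286 (m/4+3) ≤ (11/2)^(3m-2)` for `m ≥ 12`. [folklore] -/
theorem pow_A2_top {m : ℕ} (hm : 12 ≤ m) :
    ((m : ℝ) + 1) * (4 : ℝ) ^ m * (2.7182818286 * ((m : ℝ) / 4 + 3)) ≤ (11 / 2 : ℝ) ^ (3 * m - 2) := by
  induction m, hm using Nat.le_induction with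
  | base => norm_num
  | succ m hm ih =>
    have hmR : (12 : ℝ) ≤ m := by exact_mod_cast hm
    have h4 : (0 : ℝ) < (4 : ℝ) ^ m := by positivity
    rw [show 3 * (m + 1) - 2 = 3 * m - 2 + 3 by omega, pow_add (11 / 2 : ℝ) (3 * m - 2) 3,
      pow_succ (4 : ℝ) m]
    push_cast
    nlinarith [mul_le_mul_of_nonneg_right ih (by norm_num : (0 : ℝ) ≤ (11 / 2) ^ 3),
      mul_pos h4 (by linarith : (0 : ℝ) < m)]

/-- `(m+1) 4^m · 2.7182818286 (m/4+3) ≤ 13^(m+1)` for `m ≥ 12`. [folklore] -/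
theorem pow_A2_bot {m : ℕ} (hm : 12 ≤ m) :
    ((m : ℝ) + 1) * (4 : ℝ) ^ m * (2.7182818286 * ((m : ℝ) / 4 + 3)) ≤ (13 : ℝ) ^ (m + 1) := by
  induction m, hm using Nat.le_induction with
  | base => norm_num
  | succ m hm ih =>
    have hmR : (12 : ℝ) ≤ m := by exact_mod_cast hm
    have h4 : (0 : ℝ) < (4 : ℝ) ^ m := by positivity
    rw [pow_succ (13 : ℝ), pow_succ (4 : ℝ)]
    push_cast
    nlinarith [mul_le_mul_of_nonneg_right ih (by norm_num : (0 : ℝ) ≤ 13),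
      mul_pos h4 (by linarith : (0 : ℝ) < m)]

/-- The base of (A2) at the top order: `e(n-k₂+1)/((1 + (m/4) n²/(n²-2k₂)) 2k₂) ≥ 11/2`. [folklore] -/
theorem base_A2 {m n : ℝ} {k₂ : ℕ} (hm : 12 ≤ m) (hn : 2 * m ^ 2 + 2 * m + 1 ≤ n) (hk₂ : 2 * (k₂ : ℝ) ≤ 3 * m - 1)
    (hk₂1 : (1 : ℝ) ≤ k₂) :
    (11 / 2 : ℝ) ≤ Real.exp 1 * (n - k₂ + 1) / (1 + m / 4 * (n ^ 2 / (n ^ 2 - 2 * k₂))) / (2 * k₂) := by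
  have hE := Real.exp_one_gt_d9
  have hn0 : 0 < n := by nlinarith
  have hN : 5002 * (k₂ : ℝ) ≤ n ^ 2 := n_sq_ge hm hn hk₂
  have hNk : 0 < n ^ 2 - 2 * k₂ := by nlinarith
  have hratio : n ^ 2 / (n ^ 2 - 2 * k₂) ≤ 1.0004 := by
    rw [div_le_iff₀ hNk]; nlinarith
  have hden : 0 < 1 + m / 4 * (n ^ 2 / (n ^ 2 - 2 * k₂)) := by positivity
  rw [le_div_iff₀ (by positivity), le_div_iff₀ hden]
  have h1 : 1 + m / 4 * (n ^ 2 / (n ^ 2 - 2 * k₂)) ≤ 1 + m / 4 * 1.0004 := by nlinarith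
  have h2 : (11 / 2 : ℝ) * (2 * k₂) * (1 + m / 4 * (n ^ 2 / (n ^ 2 - 2 * k₂))) ≤
      (11 / 2) * (3 * m - 1) * (1 + m / 4 * 1.0004) := by
    apply mul_le_mul (by nlinarith) h1 hden.le (by nlinarith)
  have h3 : 2.7182818283 * (n - k₂ + 1) ≤ Real.exp 1 * (n - k₂ + 1) :=
    mul_le_mul_of_nonneg_right hE.le (by nlinarith)
  nlinarith [mul_nonneg (by linarith : (0 : ℝ) ≤ m - 12) (by linarith : (0 : ℝ) ≤ 1.3099 * m + 1.9538)]

set_option maxHeartbeats 400000 in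
/-- **Condition (A2)** of the tree's Case C4 split: for `m ≥ 12`, `n > 2m²+2m`, `m < 2k < 3m`:
`(m+1) 4^m (1 + (m/4) N/(N-2k))^{2k} e √(2k) < (e(n-k+1)/(2k))^{2k}` (`N = n²`; makes (12) hold for `4τ ≤ n²m`, `m < 2k`).
[cite: EfremenkoLandsbergSchenckWeyman2018, §6 (Case C4, (12))] -/
theorem cond_A2 {m n k : ℕ} (hm : 12 ≤ m) (hn : 2 * m ^ 2 + 2 * m < n) (hmk : m < 2 * k) (hk : 2 * k < 3 * m) :
    ((m : ℝ) + 1) * (4 : ℝ) ^ m * (1 + (m : ℝ) / 4 * ((n : ℝ) ^ 2 / ((n : ℝ) ^ 2 - 2 * k))) ^ (2 * k) *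
        (Real.exp 1 * √(2 * (k : ℝ))) <
      (Real.exp 1 * ((n : ℝ) - k + 1) / (2 * k)) ^ (2 * k) := by
  obtain ⟨k₂, hk₂a, hk₂b⟩ : ∃ k₂ : ℕ, 3 * m ≤ 2 * k₂ + 2 ∧ 2 * k₂ + 1 ≤ 3 * m := ⟨(3 * m - 1) / 2, by omega, by omega⟩
  set k₁ := m / 2 + 1 with hk₁def
  have hk₁k : k₁ ≤ k := by omega
  have hkk₂ : k ≤ k₂ := by omega
  have hk₁1 : 1 ≤ k₁ := by omega
  have hE1 := Real.exp_one_lt_d9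
  have he0 : 0 < Real.exp 1 := Real.exp_pos 1
  have hmR : (12 : ℝ) ≤ m := by exact_mod_cast hm
  have hnR : 2 * (m : ℝ) ^ 2 + 2 * m + 1 ≤ n := by exact_mod_cast hn
  have hk₂R : 2 * (k₂ : ℝ) ≤ 3 * m - 1 := by
    have : (2 * k₂ + 1 : ℝ) ≤ 3 * m := by exact_mod_cast hk₂b
    linarith
  have hk₂1 : (1 : ℝ) ≤ k₂ := by exact_mod_cast (hk₁1.trans (hk₁k.trans hkk₂))
  have hkk₂R : (k : ℝ) ≤ k₂ := by exact_mod_cast hkk₂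
  have hkR : (1 : ℝ) ≤ k := by exact_mod_cast (hk₁1.trans hk₁k)
  have hk3m : 2 * (k : ℝ) ≤ 3 * m - 1 := by linarith
  have hn0 : (0 : ℝ) < n := by nlinarith
  have hN : 5002 * (k₂ : ℝ) ≤ (n : ℝ) ^ 2 := n_sq_ge hmR hnR hk₂R
  have hNk : (0 : ℝ) < (n : ℝ) ^ 2 - 2 * k := by linarith
  have hNk₂ : (0 : ℝ) < (n : ℝ) ^ 2 - 2 * k₂ := by linarith
  set θ : ℝ := (m : ℝ) / 4 * ((n : ℝ) ^ 2 / ((n : ℝ) ^ 2 - 2 * k)) with hθ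
  set θ₂ : ℝ := (m : ℝ) / 4 * ((n : ℝ) ^ 2 / ((n : ℝ) ^ 2 - 2 * k₂)) with hθ₂
  have hθ0 : 0 < θ := by positivity
  have hθθ₂ : θ ≤ θ₂ := by
    rw [hθ, hθ₂]
    refine mul_le_mul_of_nonneg_left ?_ (by positivity)
    exact div_le_div_of_nonneg_left (by positivity) hNk₂ (by linarith)
  set c : ℝ := Real.exp 1 * ((n : ℝ) - k₂ + 1) / (1 + θ₂) with hc
  have hc0 : 0 < c := by rw [hc]; apply div_pos _ (by positivity); apply mul_pos he0; nlinarith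
  have hbase := base_A2 hmR hnR hk₂R hk₂1
  rw [← hθ₂, ← hc] at hbase
  set A : ℝ := ((m : ℝ) + 1) * (4 : ℝ) ^ m * (2.7182818286 * ((m : ℝ) / 4 + 3)) with hA
  have hleft : ((m : ℝ) + 1) * (4 : ℝ) ^ m * (Real.exp 1 * √(2 * (k : ℝ))) < A := by
    rw [hA]
    refine mul_lt_mul_of_pos_left ?_ (by positivity)
    have hs0 : 0 < √(2 * (k : ℝ)) := Real.sqrt_pos.2 (by positivity)
    have hs : √(2 * (k : ℝ)) ≤ (m : ℝ) / 4 + 3 :=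
      calc √(2 * (k : ℝ)) ≤ √(3 * (m : ℝ)) := Real.sqrt_le_sqrt (by linarith)
        _ ≤ (m : ℝ) / 4 + 3 := sqrt_three_mul_le m
    nlinarith
  -- endpoint `k₁`
  have hc_ge : 11 * (k₂ : ℝ) ≤ c := by
    have h := (le_div_iff₀ (by positivity : (0 : ℝ) < 2 * k₂)).1 hbase
    linarith
  have hk₂m : 3 * (m : ℝ) ≤ 2 * k₂ + 2 := by exact_mod_cast hk₂a
  have hk₁R : 2 * (k₁ : ℝ) ≤ m + 2 := by
    have : 2 * k₁ ≤ m + 2 := by omega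
    exact_mod_cast this
  have hk₁R' : (m : ℝ) + 1 ≤ 2 * k₁ := by
    have : m + 1 ≤ 2 * k₁ := by omega
    exact_mod_cast this
  have hA1 : A ≤ (c / (2 * (k₁ : ℝ))) ^ (2 * k₁) := by
    have h13 : (13 : ℝ) ≤ c / (2 * k₁) := by
      rw [le_div_iff₀ (by positivity)]; nlinarith
    have h1 : (13 : ℝ) ^ (2 * k₁) ≤ (c / (2 * (k₁ : ℝ))) ^ (2 * k₁) := pow_le_pow_left₀ (by norm_num) h13 _
    have h2 : (13 : ℝ) ^ (m + 1) ≤ (13 : ℝ) ^ (2 * k₁) := pow_le_pow_right₀ (by norm_num) (by omega)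
    exact (pow_A2_bot hm).trans (h2.trans h1)
  -- endpoint `k₂`
  have hA2 : A ≤ (c / (2 * (k₂ : ℝ))) ^ (2 * k₂) := by
    have h1 : (11 / 2 : ℝ) ^ (2 * k₂) ≤ (c / (2 * (k₂ : ℝ))) ^ (2 * k₂) :=
      pow_le_pow_left₀ (by norm_num) hbase _
    have h2 : (11 / 2 : ℝ) ^ (3 * m - 2) ≤ (11 / 2 : ℝ) ^ (2 * k₂) :=
      pow_le_pow_right₀ (by norm_num) (by omega)
    exact (pow_A2_top hm).trans (h2.trans h1)
  have hmid : A ≤ (c / (2 * (k : ℝ))) ^ (2 * k) := pow_div_ge_min hc0 hk₁1 hk₁k hkk₂ hA1 hA2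
  have hcθ : c * (1 + θ) / (2 * k) ≤ Real.exp 1 * ((n : ℝ) - k + 1) / (2 * k) := by
    refine div_le_div_of_nonneg_right ?_ (by positivity)
    have h1 : c * (1 + θ) ≤ c * (1 + θ₂) := mul_le_mul_of_nonneg_left (by linarith) hc0.le
    have hθ₂0 : 0 < 1 + θ₂ := by positivity
    have h2 : c * (1 + θ₂) = Real.exp 1 * ((n : ℝ) - k₂ + 1) := by
      rw [hc]; field_simp
    have h3 : Real.exp 1 * ((n : ℝ) - k₂ + 1) ≤ Real.exp 1 * ((n : ℝ) - k + 1) :=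
      mul_le_mul_of_nonneg_left (by linarith) he0.le
    linarith
  have hApos : 0 < A := by positivity
  calc ((m : ℝ) + 1) * (4 : ℝ) ^ m * (1 + θ) ^ (2 * k) * (Real.exp 1 * √(2 * (k : ℝ)))
      = (((m : ℝ) + 1) * (4 : ℝ) ^ m * (Real.exp 1 * √(2 * (k : ℝ)))) * (1 + θ) ^ (2 * k) := by ring
    _ < A * (1 + θ) ^ (2 * k) := mul_lt_mul_of_pos_right hleft (by positivity)
    _ ≤ (c / (2 * (k : ℝ))) ^ (2 * k) * (1 + θ) ^ (2 * k) :=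
        mul_le_mul_of_nonneg_right hmid (by positivity)
    _ = (c * (1 + θ) / (2 * k)) ^ (2 * k) := by rw [← mul_pow]; congr 1; ring
    _ ≤ (Real.exp 1 * ((n : ℝ) - k + 1) / (2 * k)) ^ (2 * k) :=
        pow_le_pow_left₀ (by positivity) hcθ _


/-! ### Binomial ratio bounds -/

/-- `binom(N+τ-1, τ) ≤ binom(N-2k+τ-1, τ) (1 + τ/(N-2k))^{2k}` for `2k < N` (ratio of the no-syzygy count to
the GKKS count). [folklore] -/
theorem choose_le_choose_sub_mul_pow {N k τ : ℕ} (hk : 2 * k + 1 ≤ N) :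
    ((N + τ - 1).choose τ : ℝ) ≤
      ((N - 2 * k + τ - 1).choose τ : ℝ) * (1 + (τ : ℝ) / ((N : ℝ) - 2 * k)) ^ (2 * k) := by
  have hid := choose_add_mul_prod (N - 2 * k + τ - 1) (N - 2 * k - 1) (2 * k)
  have e1 : (N + τ - 1).choose (N - 1) = (N + τ - 1).choose τ := by
    rw [show N + τ - 1 = (N - 1) + τ by omega]; exact Nat.choose_symm_add
  have e2 : (N - 2 * k + τ - 1).choose (N - 2 * k - 1) = (N - 2 * k + τ - 1).choose τ := by
    rw [show N - 2 * k + τ - 1 = (N - 2 * k - 1) + τ by omega]; exact Nat.choose_symm_add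
  rw [show N - 2 * k + τ - 1 + 2 * k = N + τ - 1 by omega,
    show N - 2 * k - 1 + 2 * k = N - 1 by omega, e1, e2] at hid
  have hNk : (0 : ℝ) < (N : ℝ) - 2 * k := by
    have : ((2 * k + 1 : ℕ) : ℝ) ≤ N := by exact_mod_cast hk
    push_cast at this; linarith
  have hprod_pos : (0 : ℝ) < ∏ j ∈ Finset.range (2 * k), (((N - 2 * k - 1 : ℕ) : ℝ) + 1 + j) :=
    Finset.prod_pos fun j _ => by positivity
  have hprod_le : ∏ j ∈ Finset.range (2 * k), (((N - 2 * k + τ - 1 : ℕ) : ℝ) + 1 + j) ≤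
      (1 + (τ : ℝ) / ((N : ℝ) - 2 * k)) ^ (2 * k) *
        ∏ j ∈ Finset.range (2 * k), (((N - 2 * k - 1 : ℕ) : ℝ) + 1 + j) := by
    rw [← Finset.card_range (2 * k), ← Finset.prod_const, Finset.card_range, ← Finset.prod_mul_distrib]
    refine Finset.prod_le_prod (fun j _ => by positivity) fun j _ => ?_
    have h1 : (((N - 2 * k + τ - 1 : ℕ) : ℝ) + 1 + j) = ((N : ℝ) - 2 * k + j) + τ := by
      have h := congrArg (Nat.cast : ℕ → ℝ) (show (N - 2 * k + τ - 1 : ℕ) + 1 + 2 * k = N + τ by omega)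
      push_cast at h; linarith
    have h2 : (((N - 2 * k - 1 : ℕ) : ℝ) + 1 + j) = (N : ℝ) - 2 * k + j := by
      have h := congrArg (Nat.cast : ℕ → ℝ) (show (N - 2 * k - 1 : ℕ) + 1 + 2 * k = N by omega)
      push_cast at h; linarith
    rw [h1, h2, add_mul, one_mul, add_le_add_iff_left, div_mul_eq_mul_div, le_div_iff₀ hNk]
    have : (0 : ℝ) ≤ j := by positivity
    nlinarith
  have := hid ▸ mul_le_mul_of_nonneg_left hprod_le (by positivity : (0 : ℝ) ≤ ((N - 2 * k + τ - 1).choose τ : ℝ))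
  rw [← mul_assoc] at this
  exact le_of_mul_le_mul_right this hprod_pos

/-- `binom(N+m+τ-1, m+τ) ≤ binom(N+τ-1, τ) (1 + (N-1)/(τ+1))^m`. [folklore] -/
theorem choose_add_le_choose_mul_pow (N m τ : ℕ) (hN : 1 ≤ N) :
    ((N + m + τ - 1).choose (m + τ) : ℝ) ≤
      ((N + τ - 1).choose τ : ℝ) * (1 + ((N : ℝ) - 1) / ((τ : ℝ) + 1)) ^ m := by
  have hid := choose_add_mul_prod (N + τ - 1) τ m
  rw [show N + τ - 1 + m = N + m + τ - 1 by omega, show τ + m = m + τ by omega] at hid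
  have hprod_pos : (0 : ℝ) < ∏ j ∈ Finset.range m, ((τ : ℝ) + 1 + j) :=
    Finset.prod_pos fun j _ => by positivity
  have hprod_le : ∏ j ∈ Finset.range m, (((N + τ - 1 : ℕ) : ℝ) + 1 + j) ≤
      (1 + ((N : ℝ) - 1) / ((τ : ℝ) + 1)) ^ m * ∏ j ∈ Finset.range m, ((τ : ℝ) + 1 + j) := by
    rw [← Finset.card_range m, ← Finset.prod_const, Finset.card_range, ← Finset.prod_mul_distrib]
    refine Finset.prod_le_prod (fun j _ => by positivity) fun j _ => ?_
    have h1 : (((N + τ - 1 : ℕ) : ℝ) + 1 + j) = ((τ : ℝ) + 1 + j) + ((N : ℝ) - 1) := by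
      have h := congrArg (Nat.cast : ℕ → ℝ) (show (N + τ - 1 : ℕ) + 1 = N + τ by omega)
      push_cast at h; linarith
    rw [h1, add_mul, one_mul, add_le_add_iff_left, div_mul_eq_mul_div,
      le_div_iff₀ (by positivity)]
    have : (0 : ℝ) ≤ j := by positivity
    have : (0 : ℝ) ≤ (N : ℝ) - 1 := by
      have : ((1 : ℕ) : ℝ) ≤ N := by exact_mod_cast hN
      push_cast at this; linarith
    nlinarith
  have := hid ▸ mul_le_mul_of_nonneg_left hprod_le (by positivity : (0 : ℝ) ≤ ((N + τ - 1).choose τ : ℝ))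
  rw [← mul_assoc] at this
  exact le_of_mul_le_mul_right this hprod_pos


/-! ### Case C4 -/

/-- `Σ_{j ≤ k} binom(m,j)² ≤ (k+1) binom(m,k)²` for `2k ≤ m`. [folklore] -/
theorem sum_choose_sq_le_small {m k : ℕ} (hk : 2 * k ≤ m) :
    ∑ j ∈ Finset.range (k + 1), (m.choose j) ^ 2 ≤ (k + 1) * (m.choose k) ^ 2 := by
  calc ∑ j ∈ Finset.range (k + 1), (m.choose j) ^ 2 ≤ ∑ _j ∈ Finset.range (k + 1), (m.choose k) ^ 2 :=
        Finset.sum_le_sum fun j hj =>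
          Nat.pow_le_pow_left (choose_le_choose_of_le_half (by simpa [Nat.lt_succ_iff] using hj) (by omega)) 2
    _ = (k + 1) * (m.choose k) ^ 2 := by rw [Finset.sum_const, Finset.card_range, smul_eq_mul]

/-- `Σ_{j ≤ k} binom(m,j)² ≤ (m+1) 4^m`. [folklore] -/
theorem sum_choose_sq_le_large (m k : ℕ) :
    ∑ j ∈ Finset.range (k + 1), (m.choose j) ^ 2 ≤ (m + 1) * 4 ^ m := by
  classical
  calc ∑ j ∈ Finset.range (k + 1), (m.choose j) ^ 2
      ≤ ∑ j ∈ Finset.range (k + 1), (if j ≤ m then 4 ^ m else 0) := by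
        refine Finset.sum_le_sum fun j _ => ?_
        split_ifs with hj
        · calc (m.choose j) ^ 2 ≤ (2 ^ m) ^ 2 := Nat.pow_le_pow_left (Nat.choose_le_two_pow m j) 2
            _ = 4 ^ m := by rw [← pow_mul, mul_comm, pow_mul]; norm_num
        · rw [Nat.choose_eq_zero_of_lt (by omega)]; simp
    _ = ((Finset.range (k + 1)).filter (fun j => j ≤ m)).card * 4 ^ m := by
        rw [Finset.sum_ite, Finset.sum_const_zero, add_zero, Finset.sum_const, smul_eq_mul]
    _ ≤ (m + 1) * 4 ^ m := by
        refine Nat.mul_le_mul_right _ ?_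
        calc ((Finset.range (k + 1)).filter (fun j => j ≤ m)).card ≤ (Finset.range (m + 1)).card :=
              Finset.card_le_card fun j hj => by
                simp only [Finset.mem_filter, Finset.mem_range] at hj ⊢; omega
          _ = m + 1 := Finset.card_range _

set_option maxHeartbeats 400000 in
/-- **Case C4 of ELSW Thm. 1.5** (`n - 3m/2 < k`, `τ ≤ 3n²m/2`): for `m ≥ 12`, `n > 2m²+2m`, `0 < k`,
`2k < 3m`, `2τ ≤ 3n²m`, `rank((ℓ^{n-m}perm_m)_{(k,n-k)[τ]}) < rank((det_n)_{(k,n-k)[τ]})` over any field: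
the GKKS lower bound `binom(n+k,2k) binom(n²-2k+τ-1,τ)` (`gkks_bound`) beats the smaller of the crude
bound `(Σ_j binom(m,j)²) binom(n²+τ-1,τ)` (for `4τ ≤ n²m`) and `dim S^{m+τ}ℂ^{n²}` (for `4τ > n²m`).
[cite: EfremenkoLandsbergSchenckWeyman2018, §6 (Case C4) with Thm. 1.5] -/
theorem caseC4 (K : Type*) [Field K] {m n : ℕ} (hm : 12 ≤ m) (hn : 2 * m ^ 2 + 2 * m < n) [NeZero n]
    (k τ : ℕ) (hk0 : 0 < k) (hk : 2 * k < 3 * m) (hτ : 2 * τ ≤ 3 * n ^ 2 * m) :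
    shiftedPartialsRank K k τ (paddedPerPoly K m n) <
      shiftedPartialsRank K k τ (Literature.Computability.AlgebraicComplexity.detPoly (Fin n) K) := by
  have hkn : k ≤ n := by nlinarith
  have hn1 : 1 ≤ n := by omega
  have hmn : m < n := by nlinarith
  have hkm : k + m ≤ n := by nlinarith
  set N := n ^ 2 with hNdef
  have hNn : n * n = N := by rw [hNdef, sq]
  have hG := gkks_bound K hkn hn1 τ
  rw [hNn] at hG
  refine lt_of_lt_of_le ?_ hG
  -- common real-side facts
  have hNk : 2 * k + 1 ≤ N := by nlinarith
  have hN1 : 1 ≤ N := by omega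
  have he0 := Real.exp_pos 1
  have hmR : (12 : ℝ) ≤ m := by exact_mod_cast hm
  have hnR : 2 * (m : ℝ) ^ 2 + 2 * m + 1 ≤ n := by exact_mod_cast hn
  have hkR : (1 : ℝ) ≤ k := by exact_mod_cast hk0
  have hNR : (N : ℝ) = (n : ℝ) ^ 2 := by rw [hNdef]; push_cast; ring
  have hNkR : (0 : ℝ) < (N : ℝ) - 2 * k := by
    have : ((2 * k + 1 : ℕ) : ℝ) ≤ N := by exact_mod_cast hNk
    push_cast at this; linarith
  have hτR : 2 * (τ : ℝ) ≤ 3 * (N : ℝ) * m := by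
    have : ((2 * τ : ℕ) : ℝ) ≤ ((3 * n ^ 2 * m : ℕ) : ℝ) := by exact_mod_cast hτ
    push_cast at this; rw [hNR]; linarith
  have hsq0 : 0 < Real.exp 1 * √(2 * (k : ℝ)) := mul_pos he0 (Real.sqrt_pos.2 (by positivity))
  have hR1 : (Real.exp 1 * ((n : ℝ) - k + 1) / (2 * k)) ^ (2 * k) ≤
      ((n + k).choose (2 * k) : ℝ) * (Real.exp 1 * √(2 * (k : ℝ))) := by
    have h := stirling_div_le_choose (n := n + k) (j := 2 * k) (by omega) (by omega)
    rw [div_le_iff₀ (by push_cast; exact hsq0)] at h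
    have e : Real.exp 1 * ((n : ℝ) - k + 1) / (2 * k) =
        Real.exp 1 * (((n + k : ℕ) : ℝ) + 1 - ((2 * k : ℕ) : ℝ)) / ((2 * k : ℕ) : ℝ) := by
      push_cast; ring
    rw [e]
    exact_mod_cast h
  have hR2 := choose_le_choose_sub_mul_pow (τ := τ) hNk
  have hC'0 : (0 : ℝ) < ((N - 2 * k + τ - 1).choose τ : ℝ) := by
    exact_mod_cast Nat.choose_pos (by omega)
  -- monotonicity of `(1 + τ/(N-2k))^{2k}` in `τ`
  have hbaseτ : ∀ c : ℝ, (τ : ℝ) ≤ c * N →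
      (τ : ℝ) / ((N : ℝ) - 2 * k) ≤ c * ((n : ℝ) ^ 2 / ((n : ℝ) ^ 2 - 2 * k)) := by
    intro c hc
    rw [← hNR, mul_div_assoc']
    exact div_le_div_of_nonneg_right hc hNkR.le
  have hpowτ : ∀ c : ℝ, (τ : ℝ) ≤ c * N →
      (1 + (τ : ℝ) / ((N : ℝ) - 2 * k)) ^ (2 * k) ≤ (1 + c * ((n : ℝ) ^ 2 / ((n : ℝ) ^ 2 - 2 * k))) ^ (2 * k) := by
    intro c hc
    refine pow_le_pow_left₀ (by positivity) ?_ _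
    rw [add_le_add_iff_left]
    exact hbaseτ c hc
  by_cases hA : 4 * τ ≤ N * m
  · -- Case (A): the crude bound
    have hP := shiftedPartialsRank_paddedPerPoly_le_sum_mul (K := K) hmn.le k τ
    refine lt_of_le_of_lt hP ?_
    set S := ∑ j ∈ Finset.range (k + 1), (m.choose j) ^ 2 with hS
    -- real form of the claim
    suffices h : ((S * (N + τ - 1).choose τ : ℕ) : ℝ) <
        (((n + k).choose (2 * k) * (N - 2 * k + τ - 1).choose τ : ℕ) : ℝ) by exact_mod_cast h
    push_cast
    have hτA : (τ : ℝ) ≤ (m : ℝ) / 4 * N := by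
      have : ((4 * τ : ℕ) : ℝ) ≤ ((N * m : ℕ) : ℝ) := by exact_mod_cast hA
      push_cast at this; linarith
    set θ : ℝ := (m : ℝ) / 4 * ((n : ℝ) ^ 2 / ((n : ℝ) ^ 2 - 2 * k)) with hθ
    have hθpow := hpowτ _ hτA
    have hθ1 : (0 : ℝ) ≤ (1 + θ) ^ (2 * k) := by
      refine pow_nonneg (add_nonneg zero_le_one ?_) _
      rw [hθ]
      exact mul_nonneg (by positivity) (div_nonneg (by positivity) (by rw [← hNR]; exact hNkR.le))
    -- `S (1+θ)^{2k} < binom(n+k, 2k)`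
    have hmain : (S : ℝ) * (1 + θ) ^ (2 * k) < ((n + k).choose (2 * k) : ℝ) := by
      by_cases hsmall : 2 * k ≤ m
      · have hS' : (S : ℝ) ≤ ((k : ℝ) + 1) * ((m.choose k : ℕ) : ℝ) ^ 2 := by
          have := sum_choose_sq_le_small hsmall
          rw [← hS] at this
          exact_mod_cast this
        have hc := cond_A1 hm hn hk0 hsmall
        rw [← hθ] at hc
        have h1 : (S : ℝ) * (1 + θ) ^ (2 * k) * (Real.exp 1 * √(2 * (k : ℝ))) <
            ((n + k).choose (2 * k) : ℝ) * (Real.exp 1 * √(2 * (k : ℝ))) :=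
          calc (S : ℝ) * (1 + θ) ^ (2 * k) * (Real.exp 1 * √(2 * (k : ℝ)))
              ≤ ((k : ℝ) + 1) * ((m.choose k : ℕ) : ℝ) ^ 2 * (1 + θ) ^ (2 * k) *
                  (Real.exp 1 * √(2 * (k : ℝ))) :=
                mul_le_mul_of_nonneg_right (mul_le_mul_of_nonneg_right hS' hθ1) hsq0.le
            _ < _ := hc
            _ ≤ _ := hR1
        exact lt_of_mul_lt_mul_right h1 hsq0.le
      · push Not at hsmall
        have hS' : (S : ℝ) ≤ ((m : ℝ) + 1) * (4 : ℝ) ^ m := by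
          have := sum_choose_sq_le_large m k
          rw [← hS] at this
          exact_mod_cast this
        have hc := cond_A2 hm hn hsmall hk
        rw [← hθ] at hc
        have h1 : (S : ℝ) * (1 + θ) ^ (2 * k) * (Real.exp 1 * √(2 * (k : ℝ))) <
            ((n + k).choose (2 * k) : ℝ) * (Real.exp 1 * √(2 * (k : ℝ))) :=
          calc (S : ℝ) * (1 + θ) ^ (2 * k) * (Real.exp 1 * √(2 * (k : ℝ)))
              ≤ ((m : ℝ) + 1) * (4 : ℝ) ^ m * (1 + θ) ^ (2 * k) * (Real.exp 1 * √(2 * (k : ℝ))) :=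
                mul_le_mul_of_nonneg_right (mul_le_mul_of_nonneg_right hS' hθ1) hsq0.le
            _ < _ := hc
            _ ≤ _ := hR1
        exact lt_of_mul_lt_mul_right h1 hsq0.le
    calc (S : ℝ) * ((N + τ - 1).choose τ : ℝ)
        ≤ (S : ℝ) * (((N - 2 * k + τ - 1).choose τ : ℝ) * (1 + (τ : ℝ) / ((N : ℝ) - 2 * k)) ^ (2 * k)) :=
          mul_le_mul_of_nonneg_left hR2 (by positivity)
      _ ≤ (S : ℝ) * (((N - 2 * k + τ - 1).choose τ : ℝ) * (1 + θ) ^ (2 * k)) := by gcongr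
      _ = ((S : ℝ) * (1 + θ) ^ (2 * k)) * ((N - 2 * k + τ - 1).choose τ : ℝ) := by ring
      _ < ((n + k).choose (2 * k) : ℝ) * ((N - 2 * k + τ - 1).choose τ : ℝ) :=
          mul_lt_mul_of_pos_right hmain hC'0
  · -- Case (B): `dim S^{m+τ}`
    push Not at hA
    have hP := shiftedPartialsRank_paddedPerPoly_lt_choose (K := K) (by omega : 1 ≤ m) hmn k τ hkm
    rw [show n ^ 2 + (m + τ) - 1 = N + m + τ - 1 by omega] at hP
    refine lt_of_lt_of_le hP ?_
    suffices h : (((N + m + τ - 1).choose (m + τ) : ℕ) : ℝ) ≤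
        (((n + k).choose (2 * k) * (N - 2 * k + τ - 1).choose τ : ℕ) : ℝ) by exact_mod_cast h
    push_cast
    have hR3 := choose_add_le_choose_mul_pow N m τ hN1
    have hAτ : (N : ℝ) * m < 4 * τ := by
      have : ((N * m : ℕ) : ℝ) < ((4 * τ : ℕ) : ℝ) := by exact_mod_cast hA
      push_cast at this; linarith
    have hτ0 : (0 : ℝ) < τ := by nlinarith
    have hN1R : (0 : ℝ) ≤ (N : ℝ) - 1 := by
      have : ((1 : ℕ) : ℝ) ≤ N := by exact_mod_cast hN1
      push_cast at this; linarith
    have hfac0 : (0 : ℝ) ≤ (1 + ((N : ℝ) - 1) / ((τ : ℝ) + 1)) ^ m :=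
      pow_nonneg (add_nonneg zero_le_one (div_nonneg hN1R (by positivity))) m
    -- the factor `(1 + (N-1)/(τ+1))^m ≤ (1 + x/m)^m` with `x = 4` or `2`
    have hfac : ∀ x : ℝ, (N : ℝ) * m ≤ x * τ →
        (1 + ((N : ℝ) - 1) / ((τ : ℝ) + 1)) ^ m ≤ (1 + x / m) ^ m := by
      intro x hx
      refine pow_le_pow_left₀ (add_nonneg zero_le_one (div_nonneg hN1R (by positivity))) ?_ _
      rw [add_le_add_iff_left, div_le_div_iff₀ (by positivity) (by positivity)]
      nlinarith
    have hgoal : ∀ (x c : ℝ), (N : ℝ) * m ≤ x * τ → (τ : ℝ) ≤ c * N →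
        (1 + x / (m : ℝ)) ^ m * (1 + c * ((n : ℝ) ^ 2 / ((n : ℝ) ^ 2 - 2 * k))) ^ (2 * k) *
          (Real.exp 1 * √(2 * (k : ℝ))) ≤ (Real.exp 1 * ((n : ℝ) - k + 1) / (2 * k)) ^ (2 * k) →
        ((N + m + τ - 1).choose (m + τ) : ℝ) ≤
          ((n + k).choose (2 * k) : ℝ) * ((N - 2 * k + τ - 1).choose τ : ℝ) := by
      intro x c hx hc hcond
      have h1 : (1 + x / (m : ℝ)) ^ m * (1 + c * ((n : ℝ) ^ 2 / ((n : ℝ) ^ 2 - 2 * k))) ^ (2 * k) ≤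
          ((n + k).choose (2 * k) : ℝ) :=
        le_of_mul_le_mul_right (hcond.trans hR1) hsq0
      have hxpos : 0 ≤ (1 + x / (m : ℝ)) ^ m := by
        refine pow_nonneg ?_ _
        have : 0 ≤ x := by nlinarith
        positivity
      calc ((N + m + τ - 1).choose (m + τ) : ℝ)
          ≤ ((N + τ - 1).choose τ : ℝ) * (1 + ((N : ℝ) - 1) / ((τ : ℝ) + 1)) ^ m := hR3
        _ ≤ (((N - 2 * k + τ - 1).choose τ : ℝ) * (1 + (τ : ℝ) / ((N : ℝ) - 2 * k)) ^ (2 * k)) *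
              (1 + x / (m : ℝ)) ^ m :=
            mul_le_mul hR2 (hfac x hx) hfac0 (by positivity)
        _ ≤ (((N - 2 * k + τ - 1).choose τ : ℝ) *
              (1 + c * ((n : ℝ) ^ 2 / ((n : ℝ) ^ 2 - 2 * k))) ^ (2 * k)) * (1 + x / (m : ℝ)) ^ m :=
            mul_le_mul_of_nonneg_right (mul_le_mul_of_nonneg_left (hpowτ c hc) hC'0.le) hxpos
        _ = ((1 + x / (m : ℝ)) ^ m * (1 + c * ((n : ℝ) ^ 2 / ((n : ℝ) ^ 2 - 2 * k))) ^ (2 * k)) *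
              ((N - 2 * k + τ - 1).choose τ : ℝ) := by ring
        _ ≤ ((n + k).choose (2 * k) : ℝ) * ((N - 2 * k + τ - 1).choose τ : ℝ) :=
            mul_le_mul_of_nonneg_right h1 hC'0.le
    by_cases hB : 2 * τ ≤ N * m
    · have hτB : (τ : ℝ) ≤ (m : ℝ) / 2 * N := by
        have : ((2 * τ : ℕ) : ℝ) ≤ ((N * m : ℕ) : ℝ) := by exact_mod_cast hB
        push_cast at this; linarith
      exact hgoal 4 ((m : ℝ) / 2) (by linarith) hτB (cond_B1 hm hn hk0 hk)
    · push Not at hB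
      have hτB : (τ : ℝ) ≤ 3 * (m : ℝ) / 2 * N := by linarith
      have hBR : (N : ℝ) * m ≤ 2 * τ := by
        have : ((N * m : ℕ) : ℝ) < ((2 * τ : ℕ) : ℝ) := by exact_mod_cast hB
        push_cast at this; linarith
      exact hgoal 2 (3 * (m : ℝ) / 2) hBR hτB (cond_B2 hm hn hk0 hk)

end Literature.Barriers.ValiantsHypothesis
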